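import Summits.HubbardSuperconductivity.HubbardSuperconductivity.Theorems.BalabanIRBirBdGPhaseCoercivityFourier
import Summits.HubbardSuperconductivity.HubbardSuperconductivity.Theorems.BalabanIRBirBdGPhaseCoercivitySymbols
import Summits.HubbardSuperconductivity.HubbardSuperconductivity.Theorems.BalabanIRBirSliceXYOrderRPFourier

/-!
# Route BalabanIR — crux 3 `BirBdGPhaseCoercivity` (item `stmt-HubbardSuperconductivity-2081`):
# VI. Texture modes: the pairing block in momentum space and the XY functional in Fourier form

Sixth file of the frozen-Nambu-metric reduction. For a phase texture `u_x = e^{iθ_x}` on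
`(ℤ/L)^d` with Fourier amplitudes `û(q) = Σ_x u_x χ_q(x)` (`Σ_q |û(q)|² = L^{2d}`):
* the plane-wave matrix elements of the bond pairing block `D = ½(UC + CU)` (`U = diagonal u`,
  `C` circulant with symbol `Δ`) are `D^_{kk'} = ½ L^{-d} û(k'-k) (Δ_k + Δ_{k'})`
  (`hat_pairing_apply`), so the one-loop double sum of file V reorganises mode by mode,
  `Σ_{k,k'} (|D^_{kk'}|² + |D^_{k'k}|²)/E_k = ¼ L^{-2d} Σ_q |û(q)|² Σ_k (|Δ_k+Δ_{k+q}|² + |Δ_k+Δ_{k-q}|²)/E_k`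
  (`sum_pairingHat_normSq_eq_modes`);
* on `(ℤ/L)²`, `L ≥ 3`, the XY functional of the crux is diagonal in the same modes:
  `Σ_x Σ_{y ∼ x} (1 - cos(θ_x - θ_y)) = L^{-2} Σ_q |û(q)|² (4 - 2cos q₁ - 2cos q₂)` (`xyFunctional_eq_modes`).

References: crux ideas `frozen-nambu-metric` / `sqrt-concavity-multiplier`; Friedli–Velenik 2017,
§10.4. No definition is introduced.
-/

noncomputable section

namespace Summit.HubbardSuperconductivity.HubbardSuperconductivity.Theorems

namespace BirBdG

open Matrix Finset Literature.Probability.LatticeModels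
open scoped ComplexConjugate

section General

variable {d L : ℕ} [NeZero L]

/-- **Plane-wave matrix elements of the bond pairing block**: for `U = diagonal u` and a circulant
`C` with symbol `Δ = FT(dv)`, `(½(UC + CU))^_{kk'} = ½ L^{-d} û(k'-k) (Δ_k + Δ_{k'})`,
`û(q) = Σ_x u_x χ_q(x)`. [folklore] -/
theorem hat_pairing_apply (u dv : TorusSite d L → ℂ) (k k' : TorusSite d L) :
    (((L ^ d : ℕ) : ℂ)⁻¹ • (Matrix.of (fun k x : TorusSite d L => conj (torusChar k x)) *
        ((1 / 2 : ℂ) • (Matrix.diagonal u * Matrix.circulant dv + Matrix.circulant dv * Matrix.diagonal u)) *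
        (Matrix.of fun k x : TorusSite d L => conj (torusChar k x))ᴴ)) k k' =
      (1 / 2 : ℂ) * (((L ^ d : ℕ) : ℂ)⁻¹ * ∑ x, u x * torusChar (k' - k) x) *
        (torusFourier dv k + torusFourier dv k') := by
  have hN : (L ^ d : ℕ) ≠ 0 := pow_ne_zero d (NeZero.ne L)
  have h1 := planeWave_conjTranspose_mul_self (d := d) (L := L)
  set W : Matrix (TorusSite d L) (TorusSite d L) ℂ :=
    Matrix.of (fun k x : TorusSite d L => conj (torusChar k x)) with hW
  have hlin : ((L ^ d : ℕ) : ℂ)⁻¹ • (W * ((1 / 2 : ℂ) • (Matrix.diagonal u * Matrix.circulant dv +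
      Matrix.circulant dv * Matrix.diagonal u)) * Wᴴ) =
      (1 / 2 : ℂ) • ((((L ^ d : ℕ) : ℂ)⁻¹ • (W * Matrix.diagonal u * Wᴴ)) *
        (((L ^ d : ℕ) : ℂ)⁻¹ • (W * Matrix.circulant dv * Wᴴ)) +
        (((L ^ d : ℕ) : ℂ)⁻¹ • (W * Matrix.circulant dv * Wᴴ)) *
        (((L ^ d : ℕ) : ℂ)⁻¹ • (W * Matrix.diagonal u * Wᴴ))) := by
    rw [hat_mul hN h1, hat_mul hN h1, ← smul_add, Matrix.mul_smul, Matrix.smul_mul, Matrix.mul_add,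
      Matrix.add_mul, smul_comm]
  rw [hlin, hat_circulant dv, Matrix.smul_apply, Matrix.add_apply, Matrix.mul_diagonal,
    Matrix.diagonal_mul, hat_diagonal_apply, smul_eq_mul]
  ring

omit [NeZero L] in
/-- Mode-by-mode reorganisation of a double momentum sum with convolution weights:
`Σ_{k,k'} (F(k'-k) G(k,k') + F(k-k') G(k,k')) H_k = Σ_q F(q) Σ_k (G(k,k+q) + G(k,k-q)) H_k`. [folklore] -/
theorem sum_sum_conv_weights [NeZero L] (F H : TorusSite d L → ℝ) (G : TorusSite d L → TorusSite d L → ℝ) :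
    ∑ k, ∑ k', (F (k' - k) * G k k' + F (k - k') * G k k') * H k =
      ∑ q, F q * ∑ k, (G k (k + q) + G k (k - q)) * H k := by
  have hinner : ∀ k, ∑ k', (F (k' - k) * G k k' + F (k - k') * G k k') * H k =
      ∑ q, (F q * G k (k + q) + F (-q) * G k (k + q)) * H k := by
    intro k
    rw [← Equiv.sum_comp (Equiv.addLeft k)]
    refine Finset.sum_congr rfl fun q _ => ?_
    simp only [Equiv.coe_addLeft, add_sub_cancel_left, sub_add_cancel_left]
  simp_rw [hinner]
  rw [Finset.sum_comm]
  have hsplit : ∀ q, ∑ k, (F q * G k (k + q) + F (-q) * G k (k + q)) * H k =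
      F q * ∑ k, G k (k + q) * H k + F (-q) * ∑ k, G k (k + q) * H k := by
    intro q
    rw [Finset.mul_sum, Finset.mul_sum, ← Finset.sum_add_distrib]
    refine Finset.sum_congr rfl fun k _ => ?_
    ring
  simp_rw [hsplit, Finset.sum_add_distrib]
  rw [show ∑ q, F (-q) * ∑ k, G k (k + q) * H k = ∑ q, F q * ∑ k, G k (k - q) * H k from by
    rw [← Equiv.sum_comp (Equiv.neg (TorusSite d L))]
    refine Finset.sum_congr rfl fun q _ => ?_
    simp only [Equiv.neg_apply, neg_neg, ← sub_eq_add_neg]]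
  rw [← Finset.sum_add_distrib]
  refine Finset.sum_congr rfl fun q _ => ?_
  rw [← mul_add, ← Finset.sum_add_distrib]
  congr 1
  refine Finset.sum_congr rfl fun k _ => ?_
  ring

/-- **The one-loop double sum, mode by mode.** If `|D^_{kk'}|² = ¼ N⁻² |û(k'-k)|² |Δ_k + Δ_{k'}|²`
(as for the bond pairing block, `hat_pairing_apply`), then
`Σ_{k,k'} (|D^_{kk'}|² + |D^_{k'k}|²)/E_k = ¼ N⁻² Σ_q |û(q)|² Σ_k (|Δ_k+Δ_{k+q}|² + |Δ_k+Δ_{k-q}|²)/E_k`. [folklore] -/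
theorem sum_pairingHat_normSq_eq_modes (N : ℝ) (uh : TorusSite d L → ℂ) (Δ : TorusSite d L → ℂ)
    (E : TorusSite d L → ℝ) (Dh : Matrix (TorusSite d L) (TorusSite d L) ℂ)
    (hDh : ∀ k k', Dh k k' = (1 / 2 : ℂ) * ((N : ℂ)⁻¹ * uh (k' - k)) * (Δ k + Δ k')) :
    ∑ k, ∑ k', (‖Dh k k'‖ ^ 2 + ‖Dh k' k‖ ^ 2) / E k =
      (1 / 4) * N⁻¹ ^ 2 * ∑ q, ‖uh q‖ ^ 2 *
        ∑ k, (‖Δ k + Δ (k + q)‖ ^ 2 + ‖Δ k + Δ (k - q)‖ ^ 2) / E k := by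
  have hnorm : ∀ k k', ‖Dh k k'‖ ^ 2 = (1 / 4) * N⁻¹ ^ 2 * (‖uh (k' - k)‖ ^ 2 * ‖Δ k + Δ k'‖ ^ 2) := by
    intro k k'
    rw [hDh, norm_mul, norm_mul, norm_mul, norm_inv, Complex.norm_real, Real.norm_eq_abs,
      mul_pow, mul_pow, mul_pow, inv_pow, sq_abs]
    norm_num
    ring
  have hterm : ∀ k k', (‖Dh k k'‖ ^ 2 + ‖Dh k' k‖ ^ 2) / E k =
      (1 / 4) * N⁻¹ ^ 2 * ((‖uh (k' - k)‖ ^ 2 * ‖Δ k + Δ k'‖ ^ 2 +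
        ‖uh (k - k')‖ ^ 2 * ‖Δ k + Δ k'‖ ^ 2) * (E k)⁻¹) := by
    intro k k'
    rw [hnorm, hnorm, add_comm (Δ k') (Δ k), div_eq_mul_inv]
    ring
  simp_rw [hterm, ← Finset.mul_sum]
  rw [sum_sum_conv_weights (fun q => ‖uh q‖ ^ 2) (fun k => (E k)⁻¹) (fun k k' => ‖Δ k + Δ k'‖ ^ 2)]
  simp only [div_eq_mul_inv]

/-- **Plancherel for a phase texture**: `Σ_q |û(q)|² = L^{2d}` when `|u_x| = 1` for all `x`. [cite: FriedliVelenik2017, §10.4] -/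
theorem sum_norm_sq_modes_of_unimodular (u : TorusSite d L → ℂ) (hu : ∀ x, ‖u x‖ = 1) :
    ∑ q, ‖∑ x, u x * torusChar q x‖ ^ 2 = ((L ^ d : ℕ) : ℝ) * ((L ^ d : ℕ) : ℝ) := by
  rw [BirSliceXY.sum_norm_sq_sum_mul_torusChar u]
  simp only [hu, one_pow, Finset.sum_const, Finset.card_univ, nsmul_eq_mul, mul_one]
  rw [Fintype.card_fun, ZMod.card, Fintype.card_fin]
  push_cast
  ring

end General

/-! ### The XY functional of the crux in Fourier form (`d = 2`, `L ≥ 3`) -/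

section XY

variable {L : ℕ} [NeZero L]

/-- For `L ≥ 3` the four nearest neighbours `x ± e₀`, `x ± e₁` are distinct, so the crux's
indicator sum over them is a sum of four terms. [folklore] -/
theorem sum_ite_nn_eq (hL : 3 ≤ L) (x : TorusSite 2 L) (g : TorusSite 2 L → ℝ) :
    ∑ y, (if ((y = x + ![1, 0] ∨ y = x + ![-1, 0]) ∨ (y = x + ![0, 1] ∨ y = x + ![0, -1]))
        then g y else 0) =
      g (x + Pi.single 0 1) + g (x + -Pi.single 0 1) + g (x + Pi.single 1 1) +
        g (x + -Pi.single 1 1) := by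
  have hL2 : 2 ≤ L := le_trans (by norm_num) hL
  simp only [vec_neg10, vec_neg01, vec10_eq_single, vec01_eq_single]
  -- distinctness of the four shifted points
  have hne1 : x + Pi.single 0 1 ≠ x + -Pi.single 0 1 := fun h =>
    neg_single_ne_single hL 0 (add_left_cancel h).symm
  have hne2 : x + Pi.single 1 1 ≠ x + -Pi.single 1 1 := fun h =>
    neg_single_ne_single hL 1 (add_left_cancel h).symm
  have hcross : ∀ y : TorusSite 2 L, ¬((y = x + Pi.single 0 1 ∨ y = x + -Pi.single 0 1) ∧
      (y = x + Pi.single 1 1 ∨ y = x + -Pi.single 1 1)) := by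
    rintro y ⟨h0, h1⟩
    have e0 : (y - x) 0 = 1 ∨ (y - x) 0 = -1 := by
      rcases h0 with h | h <;> simp [h]
    have e1 : (y - x) 0 = 0 := by
      rcases h1 with h | h <;> simp [h]
    rw [e1] at e0
    rcases e0 with h | h
    · exact one_ne_zero_zmod hL2 h.symm
    · exact one_ne_zero_zmod hL2 (neg_eq_zero.1 h.symm)
  -- split the indicator of the disjoint disjunctions
  have hor : ∀ (P Q : Prop) [Decidable P] [Decidable Q] (c : ℝ), ¬(P ∧ Q) →
      (if (P ∨ Q) then c else 0) = (if P then c else 0) + (if Q then c else 0) := by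
    intro P Q _ _ c h
    by_cases hP : P
    · have hQ : ¬Q := fun hQ => h ⟨hP, hQ⟩
      simp [hP, hQ]
    · by_cases hQ : Q
      · simp [hP, hQ]
      · simp [hP, hQ]
  have hsplit : ∀ y : TorusSite 2 L,
      (if ((y = x + Pi.single 0 1 ∨ y = x + -Pi.single 0 1) ∨
          (y = x + Pi.single 1 1 ∨ y = x + -Pi.single 1 1)) then g y else 0) =
        (if y = x + Pi.single 0 1 then g y else 0) + (if y = x + -Pi.single 0 1 then g y else 0) +
          ((if y = x + Pi.single 1 1 then g y else 0) + (if y = x + -Pi.single 1 1 then g y else 0)) := by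
    intro y
    rw [hor _ _ _ (hcross y), hor _ _ _ (fun h => hne1 (h.1.symm.trans h.2)),
      hor _ _ _ (fun h => hne2 (h.1.symm.trans h.2))]
  simp_rw [hsplit, Finset.sum_add_distrib, Finset.sum_ite_eq', Finset.mem_univ, if_true]
  ring

/-- Real part of a character at `± eᵢ`: `Re χ_q(eᵢ) = Re χ_q(-eᵢ) = cos pᵢ`. [cite: FriedliVelenik2017, §10.4] -/
theorem torusChar_single_re' (q : TorusSite 2 L) (i : Fin 2) :
    (torusChar q (Pi.single i 1)).re = Real.cos (latticeMomentum L q i) ∧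
      (torusChar q (-Pi.single i 1)).re = Real.cos (latticeMomentum L q i) := by
  rw [torusChar_neg_right, Complex.conj_re, torusChar_single_eq_exp, Complex.exp_ofReal_mul_I_re]
  exact ⟨rfl, rfl⟩

/-- The phase correlation along a lattice vector in Fourier form:
`Σ_x cos(θ_x - θ_{x+e}) = L^{-2} Σ_q |û(q)|² Re χ_q(e)`, `u = e^{iθ}`. [cite: FriedliVelenik2017, §10.4] -/
theorem sum_cos_sub_shift_eq (θ : TorusSite 2 L → ℝ) (e : TorusSite 2 L) :
    ∑ x, Real.cos (θ x - θ (x + e)) =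
      ((L ^ 2 : ℕ) : ℝ)⁻¹ * ∑ q, ‖∑ x, Complex.exp (Complex.I * (θ x : ℂ)) * torusChar q x‖ ^ 2 *
        (torusChar q e).re := by
  have h := sum_mul_conj_shift_eq (d := 2) (L := L) (fun x => Complex.exp (Complex.I * (θ x : ℂ))) e
  have hcos : ∀ x, Real.cos (θ x - θ (x + e)) =
      (Complex.exp (Complex.I * (θ x : ℂ)) * conj (Complex.exp (Complex.I * (θ (x + e) : ℂ)))).re := by
    intro x
    rw [← Complex.exp_conj, map_mul, Complex.conj_I, Complex.conj_ofReal, ← Complex.exp_add]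
    have : Complex.I * (θ x : ℂ) + -Complex.I * (θ (x + e) : ℂ) =
        ((θ x - θ (x + e) : ℝ) : ℂ) * Complex.I := by
      push_cast; ring
    rw [this, Complex.exp_ofReal_mul_I_re]
  simp_rw [hcos]
  rw [← Complex.re_sum, h]
  have hc : (((L ^ 2 : ℕ) : ℂ))⁻¹ = ((((L ^ 2 : ℕ) : ℝ)⁻¹ : ℝ) : ℂ) := by push_cast; rfl
  rw [hc, Complex.re_ofReal_mul, Complex.re_sum]
  congr 1
  refine Finset.sum_congr rfl fun q _ => ?_
  rw [Complex.re_ofReal_mul]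

/-- **The XY functional of the crux in Fourier form** (`L ≥ 3`):
`Σ_x Σ_{y} [y ∼ x] (1 - cos(θ_x - θ_y)) = L^{-2} Σ_q |û(q)|² (4 - 2cos q₀ - 2cos q₁)`,
`û(q) = Σ_x e^{iθ_x} χ_q(x)`: both sides of the phase-coercivity inequality are diagonal in the
texture momentum. [folklore] -/
theorem xyFunctional_eq_modes (hL : 3 ≤ L) (θ : TorusSite 2 L → ℝ) :
    ∑ x : TorusSite 2 L, ∑ y : TorusSite 2 L,
        (if ((y = x + ![1, 0] ∨ y = x + ![-1, 0]) ∨ (y = x + ![0, 1] ∨ y = x + ![0, -1]))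
          then (1 - Real.cos (θ x - θ y)) else 0) =
      ((L ^ 2 : ℕ) : ℝ)⁻¹ * ∑ q, ‖∑ x, Complex.exp (Complex.I * (θ x : ℂ)) * torusChar q x‖ ^ 2 *
        (4 - 2 * Real.cos (latticeMomentum L q 0) - 2 * Real.cos (latticeMomentum L q 1)) := by
  have hN : ((L ^ 2 : ℕ) : ℝ) ≠ 0 := by exact_mod_cast pow_ne_zero 2 (NeZero.ne L)
  simp_rw [sum_ite_nn_eq hL _ (fun y => 1 - Real.cos (θ _ - θ y))]
  simp only [Finset.sum_add_distrib, Finset.sum_sub_distrib, Finset.sum_const, Finset.card_univ,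
    nsmul_eq_mul, mul_one]
  rw [sum_cos_sub_shift_eq θ (Pi.single 0 1), sum_cos_sub_shift_eq θ (-Pi.single 0 1),
    sum_cos_sub_shift_eq θ (Pi.single 1 1), sum_cos_sub_shift_eq θ (-Pi.single 1 1)]
  have hcard : (Fintype.card (TorusSite 2 L) : ℝ) = ((L ^ 2 : ℕ) : ℝ) := by
    rw [Fintype.card_fun, ZMod.card, Fintype.card_fin]
  rw [hcard]
  have hP := sum_norm_sq_modes_of_unimodular (d := 2) (L := L)
    (fun x => Complex.exp (Complex.I * (θ x : ℂ))) (fun x => by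
      rw [mul_comm, Complex.norm_exp_ofReal_mul_I])
  -- rewrite the character real parts
  have hre : ∀ q : TorusSite 2 L,
      (torusChar q (Pi.single 0 1)).re = Real.cos (latticeMomentum L q 0) ∧
      (torusChar q (-Pi.single 0 1)).re = Real.cos (latticeMomentum L q 0) ∧
      (torusChar q (Pi.single 1 1)).re = Real.cos (latticeMomentum L q 1) ∧
      (torusChar q (-Pi.single 1 1)).re = Real.cos (latticeMomentum L q 1) := fun q =>
    ⟨(torusChar_single_re' q 0).1, (torusChar_single_re' q 0).2, (torusChar_single_re' q 1).1,
      (torusChar_single_re' q 1).2⟩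
  have hrw : ∀ q : TorusSite 2 L,
      ‖∑ x, Complex.exp (Complex.I * (θ x : ℂ)) * torusChar q x‖ ^ 2 *
        (4 - 2 * Real.cos (latticeMomentum L q 0) - 2 * Real.cos (latticeMomentum L q 1)) =
      4 * ‖∑ x, Complex.exp (Complex.I * (θ x : ℂ)) * torusChar q x‖ ^ 2 -
        (‖∑ x, Complex.exp (Complex.I * (θ x : ℂ)) * torusChar q x‖ ^ 2 * (torusChar q (Pi.single 0 1)).re +
         ‖∑ x, Complex.exp (Complex.I * (θ x : ℂ)) * torusChar q x‖ ^ 2 * (torusChar q (-Pi.single 0 1)).re +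
         ‖∑ x, Complex.exp (Complex.I * (θ x : ℂ)) * torusChar q x‖ ^ 2 * (torusChar q (Pi.single 1 1)).re +
         ‖∑ x, Complex.exp (Complex.I * (θ x : ℂ)) * torusChar q x‖ ^ 2 * (torusChar q (-Pi.single 1 1)).re) := by
    intro q
    obtain ⟨h1, h2, h3, h4⟩ := hre q
    rw [h1, h2, h3, h4]
    ring
  simp_rw [hrw, Finset.sum_sub_distrib, Finset.sum_add_distrib, ← Finset.mul_sum, hP]
  field_simp
  ring

end XY

end BirBdG

end Summit.HubbardSuperconductivity.HubbardSuperconductivity.Theorems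

end
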